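import Literature.AnabelianGeometry.EtaleTheta.SettingFreeProfinite
import Mathlib.Topology.Algebra.Category.ProfiniteGrp.Completion
import Mathlib.GroupTheory.FreeGroup.Basic
import HarnessLib

/-!
# [EtTh] §1 p. 12 "`Δ_X` is a profinite free group on 2 generators": the profinite completion of the
# free group IS free profinite — NON-VACUITY WITNESS for the cell's freeness guards (proof-only)

Mochizuki, *The étale theta function and its Frobenioid-theoretic manifestations*, Publ. RIMS **45**
(2009) [EtTh], §1, PRIMS PDF p. 12 (printed 238): "Write `Π_X := (Π^tp_X)^∧`; `Δ_X := (Δ^tp_X)^∧` …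
`Δ_X` is a profinite free group on 2 generators" [cite: MochizukiEtTh2009, §1 p.12].  abc-iut cell,
wave-5 prover seat abc-iut-w5-d218; PROOF-ONLY (no definition, no named fact), Mathlib + the two guard
files only; nothing of another seat is edited or restated.

The cell carries the printed hypothesis as two predicates phrased by a UNIVERSAL PROPERTY WITH
UNIQUENESS against finite discrete groups: `SemiGraphs.IsFreeProfiniteOn P x` (L3,
`TemperedCurves.lean`, abc-iut-L3-t2) and `EtaleTheta.IsFreeProfiniteOnTwo P` (L2 vacuity guard
`IsEtThOrigin.deltaHat_free`, `Setting.lean`, abc-iut-L2-t1; the two agree by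
`isFreeProfiniteOnTwo_iff`, abc-iut-L2-t8).  Every L2 discharge of the §1–§2 chain is stated under
`D.IsEtThOrigin` (⇔ `IsFreeProfiniteOnTwo D.DeltaHat`, `isEtThOrigin_iff_free`).  This file certifies that
the predicates are SATISFIABLE BY THE INTENDED MODEL — Mathlib's profinite completion `F̂` of the free
group `F` on the given generators (`ProfiniteGrp.ProfiniteCompletion.completion`), with the images
`η(xᵢ)` of the free generators:
* `ProfiniteCompletion.existsUnique_continuousMonoidHom_freeGroup` — for every finite discrete group
  `Q` and `a : ι → Q` there is a UNIQUE continuous homomorphism `f : F̂ → Q` with `f (η xᵢ) = aᵢ`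
  (existence: the universal property `ProfiniteCompletion.lift` of `FreeGroup.lift a`; uniqueness:
  `FreeGroup.ext_hom` and density of `η(F)` in `F̂`);
* `SemiGraphs.isFreeProfiniteOn_profiniteCompletion_freeGroup` — `IsFreeProfiniteOn F̂ (η ∘ of)`;
* `EtaleTheta.isFreeProfiniteOnTwo_profiniteCompletion_freeGroup` — `IsFreeProfiniteOnTwo F̂₂` for the
  free group on `Fin 2` (via `isFreeProfiniteOnTwo_iff`).
(Vacuity-audit input: the guard excludes nothing absurd; it does NOT, of course, produce a
`ThetaSetting` — André's tempered `π₁` is not in the tree.)  HONEST FRAMING: classical profinite group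
theory (Ribes–Zalesskii, *Profinite Groups*, §3.3); nothing of [EtTh] is asserted; no side is taken on
any disputed claim.
-/

noncomputable section

open CategoryTheory Topology

universe u

namespace Literature.Topology.Algebra.ProfiniteCompletion

/-- **The profinite completion of a free group is free profinite on the images of the free
generators**: for every finite discrete group `Q` and every assignment `a : ι → Q` there is a unique
continuous homomorphism `f : F̂ → Q` with `f (η (of i)) = a i` for all `i` — existence by the universal
property of the profinite completion applied to `FreeGroup.lift a`, uniqueness because two such maps
agree on the dense image of the free group (`FreeGroup.ext_hom`). (Ribes–Zalesskii, *Profinite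
Groups*, Prop. 3.3.2/3.3.6.) [cite: MochizukiEtTh2009, §1 p.12] -/
theorem existsUnique_continuousMonoidHom_freeGroup (ι : Type u) (Q : Type u) [Group Q] [Finite Q]
    [TopologicalSpace Q] [DiscreteTopology Q] (a : ι → Q) :
    ∃! f : ProfiniteGrp.ProfiniteCompletion.completion (GrpCat.of (FreeGroup ι)) →ₜ* Q,
      ∀ i, f (ProfiniteGrp.ProfiniteCompletion.etaFn (GrpCat.of (FreeGroup ι)) (FreeGroup.of i)) = a i := by
  classical
  let G : GrpCat.{u} := GrpCat.of (FreeGroup ι)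
  let P : ProfiniteGrp.{u} := ProfiniteGrp.of Q
  let φ : G ⟶ GrpCat.of P := GrpCat.ofHom (FreeGroup.lift a)
  let L := ProfiniteGrp.ProfiniteCompletion.lift φ
  have hL : ∀ g : FreeGroup ι,
      L.hom (ProfiniteGrp.ProfiniteCompletion.etaFn G g) = FreeGroup.lift a g := by
    intro g
    have h := ConcreteCategory.congr_hom (ProfiniteGrp.ProfiniteCompletion.lift_eta φ) g
    simp only [GrpCat.comp_apply] at h
    exact h
  refine ⟨L.hom, fun i => by rw [hL, FreeGroup.lift_apply_of], fun f hf => ?_⟩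
  -- uniqueness: `f ∘ η = L ∘ η` on the free group, then density
  have hη : ∀ g : FreeGroup ι,
      f (ProfiniteGrp.ProfiniteCompletion.etaFn G g) = L.hom (ProfiniteGrp.ProfiniteCompletion.etaFn G g) := by
    intro g
    have key : f.toMonoidHom.comp (ProfiniteGrp.ProfiniteCompletion.eta G).hom =
        L.hom.toMonoidHom.comp (ProfiniteGrp.ProfiniteCompletion.eta G).hom := by
      refine FreeGroup.ext_hom _ _ fun i => ?_
      change f (ProfiniteGrp.ProfiniteCompletion.etaFn G (FreeGroup.of i)) =
        L.hom (ProfiniteGrp.ProfiniteCompletion.etaFn G (FreeGroup.of i))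
      rw [hf i, hL, FreeGroup.lift_apply_of]
    exact DFunLike.congr_fun key g
  have heq : (f : ProfiniteGrp.ProfiniteCompletion.completion G → Q) = L.hom :=
    (ProfiniteGrp.ProfiniteCompletion.denseRange (G := G)).equalizer f.continuous_toFun
      L.hom.continuous_toFun (funext hη)
  exact ContinuousMonoidHom.ext fun z => congrFun heq z

end Literature.Topology.Algebra.ProfiniteCompletion

namespace Literature.AnabelianGeometry.SemiGraphs

/-- **Non-vacuity of the L3 freeness predicate**: the profinite completion `F̂` of the free group on
`ι` is free profinite, in the sense of `IsFreeProfiniteOn`, on the images `η (of i)` of the free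
generators ([SemiAnbd] §6 / [EtTh] p. 12 "a profinite free group on 2 generators": the intended model
satisfies the interface axiom `OncePuncturedTemperedGroup.deltaHat_free`).
[cite: MochizukiEtTh2009, §1 p.12] -/
theorem isFreeProfiniteOn_profiniteCompletion_freeGroup (ι : Type u) :
    IsFreeProfiniteOn (ProfiniteGrp.ProfiniteCompletion.completion (GrpCat.of (FreeGroup ι)))
      (fun i : ι =>
        ProfiniteGrp.ProfiniteCompletion.etaFn (GrpCat.of (FreeGroup ι)) (FreeGroup.of i)) :=
  fun Q _ _ _ _ a =>
    Literature.Topology.Algebra.ProfiniteCompletion.existsUnique_continuousMonoidHom_freeGroup ι Q a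

end Literature.AnabelianGeometry.SemiGraphs

namespace Literature.AnabelianGeometry.EtaleTheta

open Literature.AnabelianGeometry.SemiGraphs

/-- **Non-vacuity of the L2 guard `IsFreeProfiniteOnTwo`** (the field `IsEtThOrigin.deltaHat_free`,
[EtTh] p. 12 "`Δ_X` is a profinite free group on 2 generators"): the profinite completion of the free
group on two generators satisfies it — compact, Hausdorff, totally disconnected, and free on the pair
`(η x₀, η x₁)` against every finite discrete group. [cite: MochizukiEtTh2009, §1 p.12] -/
theorem isFreeProfiniteOnTwo_profiniteCompletion_freeGroup :
    IsFreeProfiniteOnTwo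
      (ProfiniteGrp.ProfiniteCompletion.completion (GrpCat.of (FreeGroup (Fin 2)))) :=
  (isFreeProfiniteOnTwo_iff _).mpr
    ⟨inferInstance, inferInstance, inferInstance,
      ⟨fun i => ProfiniteGrp.ProfiniteCompletion.etaFn (GrpCat.of (FreeGroup (Fin 2))) (FreeGroup.of i),
        isFreeProfiniteOn_profiniteCompletion_freeGroup (Fin 2)⟩⟩

/-- The guard is satisfiable: SOME profinite topological group is free profinite on two generators in
the cell's sense (`IsFreeProfiniteOnTwo`). [cite: MochizukiEtTh2009, §1 p.12] -/
theorem exists_isFreeProfiniteOnTwo :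
    ∃ (P : Type) (_ : Group P) (_ : TopologicalSpace P), IsFreeProfiniteOnTwo P :=
  ⟨_, inferInstance, inferInstance, isFreeProfiniteOnTwo_profiniteCompletion_freeGroup⟩

end Literature.AnabelianGeometry.EtaleTheta

end
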